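import Literature.Geometry.Kaehler.ComplexTorusAutomorphismFiniteSubgroupsConjugacyFinite
import Literature.Geometry.Kaehler.ComplexTorusSubtorusEndomorphismAlgebra
import Literature.Geometry.Kaehler.ComplexTorusDirectFactorsFinite
import Literature.Geometry.Kaehler.ComplexTorusAnalyticCharpoly
import HarnessLib

/-!
# Lenstra–Oort–Zarhin: up to isomorphism, a complex abelian variety has only finitely many abelian subvarieties
# — via the Jordan–Zassenhaus theorem (torus level)

Layer `Literature/Geometry/Kaehler`, namespace `Literature.Geometry.Kaehler.ComplexTorus`; lane `lit-hodgefound`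
(Track 2 foundations library), seat p19 generation 47, row g47-#3 — the successor desk (δ) of generation 46.  A
JUNCTION row: the counting device `JordanZassenhaus.finite_quot_linearEquiv_span_singleton_of_isLattice` of row
g47-#1 (`Algebra/Module/OrderUnitsFiniteSubgroupConjugacyClassesFinite`: finitely many classes of pairs
(principal left ideal `Bx`, `Λ`-stable full lattice `L ⊆ Bx`) in a finite-dimensional semisimple `ℚ`-algebra `B`
with an order `Λ`, by the Jordan–Zassenhaus theorem of row g46-#2) meets the torus vocabulary of the tree:
abelian subvarieties `Y_W = Φ(W)/Φ(W ∩ ℤ^ι)` of `X = E/Φ(ℤ^ι)` (`subtorusPeriod`, `IsLatticeSubspace`,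
`IsComplexSubspace`, the lattice frame `subtorusMatrix W` and retraction `retractionMatrix W` of
`ComplexTorusSubtorusQuotient`), the symmetric idempotents `ε_W ∈ End⁰(X) = endAlgRat Φ` of a polarisation
(`symmIdempotentElem`, Lange Thm. 2.4.19, `ComplexTorusSubtorusEndomorphismAlgebra`), the order
`End(X) = endSubmodule Φ ⊆ End⁰(X)` (`ComplexTorusMaximalOrderQuotient`), the analytic representation
`analyticRepHom` (`ComplexTorusAnalyticCharpoly`), isomorphism of tori `IsIsomorphic` and the criterion
`isIsomorphic_subtorusPeriod_of_injective` (`ComplexTorusStablyNondegenerateSubquotients`).  THEOREMS ONLY (no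
definition, no instance, no named fact; D-0026 net Literature debt `0`; no `sorry`).

## Sources

H. W. Lenstra Jr., F. Oort, Yu. G. Zarhin, *Abelian subvarieties*, J. Algebra 180 (1996) 513–516
[LenstraOortZarhin1996AbelianSubvarieties] — NOT HELD (paywalled; acquisition request acq-14613; `lit reconstruct`:
statement only).  The statement, VERBATIM from a held secondary source, F. Caucci, *Kobayashi hyperbolicity of
complete linear systems on abelian varieties* (arXiv:2512.10082, 2025) [Caucci2025KobayashiHyperbolicityAbelian],
chunk p0008: «given `A`, there are, up to isomorphism, only finitely many abelian subvarieties in `A` (see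
[lenstra])».  The PROOF below is the lane's own, through Jordan–Zassenhaus (the printed proof was not available);
its pattern is that of J. S. Milne, *Abelian varieties* (1986) [Milne1986AbelianVarieties] §18 Thm. 18.7 /
Lemma 18.8 (finiteness of direct factors through finiteness of orbits of an arithmetic group — here replaced by
the Jordan–Zassenhaus theorem, as in rows g46-#3/#5).  Torus vocabulary: H. Lange, *Abelian Varieties over the
Complex Numbers* (2023) [Lange2023AbelianVarietiesComplex], §1.1.2 Prop. 1.1.6 (analytic and rational
representations, `ρ_r` injective), §1.1.6 Exercise (2)(a) (subtori `Y = V/(V ∩ Λ)`) and (3), §2.4.3 Thm. 2.4.19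
(abelian subvarieties ↔ symmetric idempotents `ε_Y`), §2.4.4 Cor. 2.4.26 (`End_ℚ(X)` semisimple).

## The proof formalised

Let `X` be a complex abelian variety, `A = End⁰(X)` (a finite-dimensional semisimple `ℚ`-algebra), `R = End(X)`
(an order of `A`), `Λ = H₁(X, ℤ) = ℤ^ι`.  To an abelian subvariety `Y = Y_W` attach the pair
(`Hom⁰(Y, X) = Aε_W`, `Hom(Y, X) = {a ∈ Aε_W : a(Λ ∩ W) ⊆ Λ}`): a principal left ideal of `A` and an `R`-stable
full `ℤ`-lattice in it (§2; `a(Λ ∩ W) ⊆ Λ` is the integrality of the matrix `aP_W`, `P_W = C_W R_W ∈ M_ι(ℤ)` the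
projector onto `Λ ∩ W`, §1).  By `finite_quot_linearEquiv_span_singleton_of_isLattice` these pairs fall into
finitely many classes under `A`-linear isomorphisms `γ : Aε_W ≃ Aε_{W′}` with `γ(Hom(Y_W, X)) = Hom(Y_{W′}, X)`.
Such a `γ` is right multiplication by `c = γ(ε_W)`, with inverse right multiplication by `d = γ⁻¹(ε_{W′})`,
`cd = ε_W`, `dc = ε_{W′}`; `c ∈ Hom(Y_{W′}, X)` (the image of `ε_W ∈ Hom(Y_W, X)`) and `d ∈ Hom(Y_W, X)` (the
preimage of `ε_{W′}`), i.e. `c(Λ ∩ W′) ⊆ Λ ∩ W` and `d(Λ ∩ W) ⊆ Λ ∩ W′`; as `cd`, `dc` are the identities of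
`W`, `W′`, the map `d` is an isomorphism `W ⥲ W′` carrying `Λ ∩ W` onto `Λ ∩ W′`, `ℂ`-linear since `d ∈ End⁰(X)`
— an isomorphism `Y_W ≅ Y_{W′}` (§3, through the tree's `isIsomorphic_subtorusPeriod_of_injective` applied to the
injective homomorphism `Y_W → X` with matrix `(dP_W)C_W = C_{W′}N`, `N` unimodular).

* §1 `latticeProj_mulVec_of_mem`, `latticeProj_mulVec_mem`, `intVec_mem_iff_exists_latticeProj_mulVec` — the
  integral projector `P_W = C_W R_W` onto `Λ ∩ W`.
* §2 `exists_homLattice` (the `ℤ`-submodule `L_W = {a ∈ End⁰(X) : aP_W ∈ M_ι(ℤ)}`),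
  `symmIdempotentElem_mem_homLattice` (`ε_W ∈ L_W`), `smul_mem_homLattice` (`End(X)L_W ⊆ L_W`),
  `eq_zero_of_mem_span_symmIdempotentElem_of_mul_latticeProj_eq_zero` (`a ∈ Aε_W` is determined by `aP_W`),
  **`isLattice_comap_homLattice`** (`Hom(Y_W, X) = L_W ∩ Aε_W` is a full `End(X)`-stable lattice of `Aε_W`).
* §3 **`isIsomorphic_subtorusPeriod_of_intertwiner`** (the geometric step: `c, d` as above give `Y_W ≅ Y_{W′}`),
  **`isIsomorphic_subtorusPeriod_of_linearEquiv`** (the algebraic step: an isomorphism of pairs gives `c, d`).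
* §4 **`IsRiemannForm.finite_quot_isIsomorphic_subtorusPeriod`**, **`IsAbelianVariety.finite_quot_isIsomorphic_subtorusPeriod`**
  — LENSTRA–OORT–ZARHIN for complex abelian varieties: `Finite (Quot …)` of the abelian subvarieties
  `{W // IsLatticeSubspace W ∧ IsComplexSubspace Φ W}` modulo `IsIsomorphic` of the subtori `subtorusPeriod Φ W`.
-- TODO(general form): the printed theorem is over an arbitrary field `k` (finitely many abelian subvarieties up to
-- `k`-isomorphism); only the complex-analytic case `k = ℂ` is formalised here.

## References
* [LenstraOortZarhin1996AbelianSubvarieties] H. W. Lenstra Jr., F. Oort, Yu. G. Zarhin, *Abelian subvarieties*, J. Algebra 180 (1996), 513–516 (statement; not held, acq-14613).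
* [Caucci2025KobayashiHyperbolicityAbelian] F. Caucci, *Kobayashi hyperbolicity of complete linear systems on abelian varieties*, arXiv:2512.10082 (2025), footnote citing [LOZ] (held, chunk p0008: the statement verbatim).
* [Milne1986AbelianVarieties] J. S. Milne, *Abelian varieties*, in Cornell–Silverman (eds.), *Arithmetic Geometry*, Springer 1986, §18 Thm. 18.7, Lemma 18.8 (method).
* [Lange2023AbelianVarietiesComplex] H. Lange, *Abelian Varieties over the Complex Numbers*, Springer 2023, §1.1.2 Prop. 1.1.6, §1.1.6 Ex. (2)(a), (3), §2.4.3 Thm. 2.4.19, §2.4.4 Cor. 2.4.26.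
* [SwanEvans1970] R. G. Swan, E. G. Evans, *K-Theory of Finite Groups and Orders*, LNM 149, Springer 1970, Ch. 3 Thm. 3.9 (Jordan–Zassenhaus).
-/

noncomputable section

open Module Function Matrix

namespace Literature.Geometry.Kaehler

namespace ComplexTorus

open Literature.Algebra.Module

/-! ## §0 Cast and matrix helpers -/

section Helpers

variable {m n o : Type*} [Fintype m] [Fintype n] [Fintype o]

omit [Fintype m] [Fintype o] in
/-- `(A B)_ℝ = A_ℝ B_ℝ` for rational matrices. [folklore] -/
private theorem map_ratCast_mul (A : Matrix m n ℚ) (B : Matrix n o ℚ) :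
    (A * B).map (Rat.cast : ℚ → ℝ) = A.map (Rat.cast : ℚ → ℝ) * B.map (Rat.cast : ℚ → ℝ) :=
  Matrix.map_mul (f := Rat.castHom ℝ)

omit [Fintype m] [Fintype o] in
/-- `(M N)_ℚ = M_ℚ N_ℚ` for integer matrices. [folklore] -/
private theorem map_intCast_mul_rat (M : Matrix m n ℤ) (N : Matrix n o ℤ) :
    (M * N).map (Int.cast : ℤ → ℚ) = M.map (Int.cast : ℤ → ℚ) * N.map (Int.cast : ℤ → ℚ) :=
  Matrix.map_mul (f := Int.castRingHom ℚ)

omit [Fintype m] [Fintype n] in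
/-- `ℤ → ℚ → ℝ` casts of an integer matrix. [folklore] -/
private theorem map_intCast_map_ratCast (M : Matrix m n ℤ) :
    (M.map (Int.cast : ℤ → ℚ)).map (Rat.cast : ℚ → ℝ) = M.map (Int.cast : ℤ → ℝ) :=
  Matrix.ext fun i j => Rat.cast_intCast (M i j)

omit [Fintype m] in
/-- A real matrix is determined by its action on vectors. [folklore] -/
private theorem matrix_eq_of_mulVec_eq [DecidableEq n] {M N : Matrix m n ℝ} (h : ∀ x, M *ᵥ x = N *ᵥ x) :
    M = N :=
  Matrix.ext fun i j => by simpa [Matrix.mulVec_single] using congr_fun (h (Pi.single j 1)) i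

omit [Fintype m] in
/-- A rational matrix is determined by the real action of its cast. [folklore] -/
private theorem ratMatrix_eq_of_mulVec_eq [DecidableEq n] {M N : Matrix m n ℚ}
    (h : ∀ x : n → ℝ, M.map (Rat.cast : ℚ → ℝ) *ᵥ x = N.map (Rat.cast : ℚ → ℝ) *ᵥ x) : M = N :=
  Matrix.map_injective Rat.cast_injective (matrix_eq_of_mulVec_eq h)

omit [Fintype m] in
/-- An integer matrix is determined by the real action of its cast. [folklore] -/
private theorem intMatrix_eq_of_mulVec_eq [DecidableEq n] {M N : Matrix m n ℤ}
    (h : ∀ x : n → ℝ, M.map (Int.cast : ℤ → ℝ) *ᵥ x = N.map (Int.cast : ℤ → ℝ) *ᵥ x) : M = N :=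
  Matrix.map_injective Int.cast_injective (matrix_eq_of_mulVec_eq h)

/-- The integer matrices inside `M_n(ℚ)` are the `ℤ`-span of the matrix units. [folklore] -/
private theorem mem_span_single_iff_exists_int [DecidableEq n] (x : Matrix n n ℚ) :
    x ∈ Submodule.span ℤ (Set.range fun p : n × n => Matrix.single p.1 p.2 (1 : ℚ)) ↔
      ∃ M : Matrix n n ℤ, (Int.castRingHom ℚ).mapMatrix M = x := by
  constructor
  · intro hx
    induction hx using Submodule.span_induction with
    | mem y hy =>
      obtain ⟨⟨i, j⟩, rfl⟩ := hy
      exact ⟨Matrix.single i j 1, by rw [RingHom.mapMatrix_apply, Matrix.map_single, map_one]⟩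
    | zero => exact ⟨0, map_zero _⟩
    | add y z _ _ hy hz =>
      obtain ⟨M, rfl⟩ := hy
      obtain ⟨N, rfl⟩ := hz
      exact ⟨M + N, map_add _ _ _⟩
    | smul k y _ hy =>
      obtain ⟨M, rfl⟩ := hy
      exact ⟨k • M, map_zsmul _ _ _⟩
  · rintro ⟨M, rfl⟩
    rw [Matrix.matrix_eq_sum_single ((Int.castRingHom ℚ).mapMatrix M)]
    refine Submodule.sum_mem _ fun i _ => Submodule.sum_mem _ fun j _ => ?_
    have : Matrix.single i j (((Int.castRingHom ℚ).mapMatrix M) i j) = (M i j : ℤ) • Matrix.single i j (1 : ℚ) := by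
      rw [RingHom.mapMatrix_apply, Matrix.map_apply, eq_intCast, ← Int.cast_smul_eq_zsmul ℚ, Matrix.smul_single,
        smul_eq_mul, mul_one]
    rw [this]
    exact Submodule.smul_mem _ _ (Submodule.subset_span ⟨(i, j), rfl⟩)

omit [Fintype m] [Fintype o] in
/-- `mapMatrix` of the integer cast is the entrywise cast. [folklore] -/
private theorem mapMatrix_intCastRingHom [DecidableEq n] (M : Matrix n n ℤ) :
    (Int.castRingHom ℚ).mapMatrix M = M.map (Int.cast : ℤ → ℚ) := rfl

omit [Fintype m] [Fintype o] in
/-- `(M N)_ℝ = M_ℝ N_ℝ` for integer matrices. [folklore] -/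
private theorem map_intCast_mul_real (M : Matrix m n ℤ) (N : Matrix n o ℤ) :
    (M * N).map (Int.cast : ℤ → ℝ) = M.map (Int.cast : ℤ → ℝ) * N.map (Int.cast : ℤ → ℝ) :=
  Matrix.map_mul (f := Int.castRingHom ℝ)

omit [Fintype m] in
/-- `M_ℝ (intVec v) = intVec (M v)` for an integer matrix. [folklore] -/
private theorem map_intCast_mulVec_intVec (M : Matrix m n ℤ) (v : n → ℤ) :
    (M.map (Int.cast : ℤ → ℝ)) *ᵥ intVec v = intVec (M *ᵥ v) := by
  funext i
  simp [Matrix.mulVec, dotProduct, intVec]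

/-- `M_n(ℤ)` is a full `ℤ`-lattice of `M_n(ℚ)`. [folklore] -/
private theorem isLattice_span_single [DecidableEq n] :
    (Submodule.span ℤ (Set.range fun p : n × n => Matrix.single p.1 p.2 (1 : ℚ))).IsLattice ℚ := by
  refine ⟨Submodule.fg_span (Set.finite_range _), ?_⟩
  rw [Submodule.span_span_of_tower, Submodule.eq_top_iff']
  intro x
  rw [Matrix.matrix_eq_sum_single x]
  refine Submodule.sum_mem _ fun i _ => Submodule.sum_mem _ fun j _ => ?_
  rw [show Matrix.single i j (x i j) = x i j • Matrix.single i j (1 : ℚ) by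
    rw [Matrix.smul_single, smul_eq_mul, mul_one]]
  exact Submodule.smul_mem _ _ (Submodule.subset_span ⟨(i, j), rfl⟩)

end Helpers

variable {ι : Type*} [Fintype ι] [DecidableEq ι] {E : Type*} [NormedAddCommGroup E] [NormedSpace ℂ E]
  (Φ : (ι → ℝ) ≃L[ℝ] E)

/-! ## §1 The lattice projector `P_W = C_W R_W ∈ M_ι(ℤ)` onto `Λ ∩ W` -/

section Projector

variable {W : Submodule ℝ (ι → ℝ)}

omit [DecidableEq ι] in
/-- `P_W = C_W R_W` (the lattice frame of `W` followed by its integral retraction) fixes `W` pointwise: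
`P_W w = w` for `w ∈ W`. [cite: Lange2023AbelianVarietiesComplex, §1.1.6 Exercise (2)(a), p. 26] -/
theorem latticeProj_mulVec_of_mem (hW : IsLatticeSubspace W) {w : ι → ℝ} (hw : w ∈ W) :
    ((subtorusMatrix W * retractionMatrix W).map (Int.cast : ℤ → ℝ)) *ᵥ w = w := by
  rw [map_intCast_mul_real, ← Matrix.mulVec_mulVec]
  exact subtorusMatrix_mulVec_retractionMatrix_mulVec hW hw

omit [DecidableEq ι] in
/-- `P_W x ∈ W` for every `x`. [cite: Lange2023AbelianVarietiesComplex, §1.1.6 Exercise (2)(a), p. 26] -/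
theorem latticeProj_mulVec_mem (x : ι → ℝ) :
    ((subtorusMatrix W * retractionMatrix W).map (Int.cast : ℤ → ℝ)) *ᵥ x ∈ W := by
  rw [map_intCast_mul_real, ← Matrix.mulVec_mulVec]
  exact subtorusMatrix_mulVec_mem W _

omit [DecidableEq ι] in
/-- The lattice vectors of `W` are exactly the `P_W m`, `m ∈ ℤ^ι`: `Λ ∩ W = P_W ℤ^ι`.
[cite: Lange2023AbelianVarietiesComplex, §1.1.6 Exercise (2)(a), p. 26] -/
theorem intVec_mem_iff_exists_latticeProj_mulVec (hW : IsLatticeSubspace W) {v : ι → ℝ} :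
    (v ∈ W ∧ ∃ m : ι → ℤ, intVec m = v) ↔
      ∃ m : ι → ℤ, intVec ((subtorusMatrix W * retractionMatrix W) *ᵥ m) = v := by
  constructor
  · rintro ⟨hv, m, rfl⟩
    exact ⟨m, by rw [← map_intCast_mulVec_intVec, latticeProj_mulVec_of_mem hW hv]⟩
  · rintro ⟨m, rfl⟩
    exact ⟨by rw [← map_intCast_mulVec_intVec]; exact latticeProj_mulVec_mem (intVec m), _, rfl⟩

end Projector

/-! ## §2 The lattice `Hom(Y_W, X) = {a ∈ End⁰(X)·ε_W : a(Λ ∩ W) ⊆ Λ}` inside the left ideal `End⁰(X)·ε_W` -/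

section HomLattice

variable {W : Submodule ℝ (ι → ℝ)}

/-- **The integrality condition `a(Λ ∩ W) ⊆ Λ` as a `ℤ`-submodule of `End⁰(X)`**: there is a `ℤ`-submodule
`L_W ⊆ End⁰(X) = endAlgRat Φ` with `a ∈ L_W ↔ a·P_W ∈ M_ι(ℤ)` (`P_W = C_W R_W` the integral projector onto
`Λ ∩ W`), namely the preimage of `M_ι(ℤ)` under `a ↦ a P_W`. [cite: Lange2023AbelianVarietiesComplex, §1.1.2 Prop. 1.1.6 («`ρ_r(f)` is the restriction of `ρ_a(f)` to the lattice»), p. 20] -/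
theorem exists_homLattice (W : Submodule ℝ (ι → ℝ)) : ∃ L : Submodule ℤ (endAlgRat Φ), ∀ a : endAlgRat Φ,
    a ∈ L ↔ ∃ M : Matrix ι ι ℤ, M.map (Int.cast : ℤ → ℚ) =
      (a : Matrix ι ι ℚ) * (subtorusMatrix W * retractionMatrix W).map (Int.cast : ℤ → ℚ) := by
  refine ⟨(Submodule.span ℤ (Set.range fun p : ι × ι => Matrix.single p.1 p.2 (1 : ℚ))).comap
    ((LinearMap.mulRight ℤ ((subtorusMatrix W * retractionMatrix W).map (Int.cast : ℤ → ℚ))).comp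
      ((endAlgRat Φ).val.toLinearMap.restrictScalars ℤ)), fun a => ?_⟩
  rw [Submodule.mem_comap, mem_span_single_iff_exists_int]
  rfl

variable {η : E [⋀^Fin 2]→L[ℝ] ℝ} (hη : IsRiemannForm Φ η) (hW : IsLatticeSubspace W) (hWc : IsComplexSubspace Φ W)

/-- The real action of `ε_W ∈ End⁰(X)`: `(ε_W)_ℝ x ∈ W` and `= x` on `W`; hence `ε_W P_W = P_W`.
[cite: Lange2023AbelianVarietiesComplex, §2.4.3 Thm. 2.4.19 and §5.3.1, pp. 121, 159] -/
theorem symmIdempotent_mul_latticeProj :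
    symmIdempotent Φ hη hW hWc * (subtorusMatrix W * retractionMatrix W).map (Int.cast : ℤ → ℚ) =
      (subtorusMatrix W * retractionMatrix W).map (Int.cast : ℤ → ℚ) := by
  refine ratMatrix_eq_of_mulVec_eq fun x => ?_
  rw [map_ratCast_mul, ← Matrix.mulVec_mulVec, map_intCast_map_ratCast,
    symmIdempotent_mulVec_of_mem Φ hη hW hWc (latticeProj_mulVec_mem x)]

/-- `ε_W ∈ Hom(Y_W, X)`: the projector `ε_W` restricts to the inclusion `Y_W ↪ X` («the inclusion lies in
`Hom(Y, X)`»). [cite: Lange2023AbelianVarietiesComplex, §2.4.3 (the norm-endomorphism `N_Y = e(Y)ε_Y ∈ End(X)` restricts to `e(Y)_Y`), p. 121] -/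
theorem symmIdempotentElem_mem_homLattice {L : Submodule ℤ (endAlgRat Φ)}
    (hL : ∀ a : endAlgRat Φ, a ∈ L ↔ ∃ M : Matrix ι ι ℤ, M.map (Int.cast : ℤ → ℚ) =
      (a : Matrix ι ι ℚ) * (subtorusMatrix W * retractionMatrix W).map (Int.cast : ℤ → ℚ)) :
    symmIdempotentElem Φ hη hW hWc ∈ L :=
  (hL _).mpr ⟨_, (symmIdempotent_mul_latticeProj Φ hη hW hWc).symm⟩

/-- `Hom(Y_W, X)` is a left `End(X)`-module: `End(X) · L_W ⊆ L_W` (composition with an integral endomorphism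
keeps `a(Λ ∩ W) ⊆ Λ`). [cite: Lange2023AbelianVarietiesComplex, §1.1.2 Prop. 1.1.6, p. 20] -/
theorem smul_mem_homLattice {L : Submodule ℤ (endAlgRat Φ)}
    (hL : ∀ a : endAlgRat Φ, a ∈ L ↔ ∃ M : Matrix ι ι ℤ, M.map (Int.cast : ℤ → ℚ) =
      (a : Matrix ι ι ℚ) * (subtorusMatrix W * retractionMatrix W).map (Int.cast : ℤ → ℚ)) :
    ∀ r ∈ endSubmodule Φ, ∀ a ∈ L, r • a ∈ L := by
  intro r hr a ha
  obtain ⟨α, rfl⟩ := (mem_endSubmodule_iff_exists_endToEndAlgRat Φ).mp hr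
  obtain ⟨M, hM⟩ := (hL a).mp ha
  refine (hL _).mpr ⟨(α : Matrix ι ι ℤ) * M, ?_⟩
  rw [smul_eq_mul, Subalgebra.coe_mul, coe_endToEndAlgRat, Matrix.mul_assoc, ← hM, map_intCast_mul_rat]

omit [DecidableEq ι] in
/-- A subgroup of a finitely generated abelian group is finitely generated. [folklore] -/
private theorem fg_of_le' {V : Type*} [AddCommGroup V] {N L : Submodule ℤ V} (hL : L.FG) (h : N ≤ L) : N.FG := by
  haveI : Module.Finite ℤ L := Module.Finite.iff_fg.mpr hL
  haveI : IsNoetherian ℤ L := isNoetherian_of_isNoetherianRing_of_finite ℤ L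
  have h1 : (N.comap L.subtype).map L.subtype = N := by
    rw [Submodule.map_comap_subtype, inf_eq_right.mpr h]
  rw [← h1]
  exact (IsNoetherian.noetherian _).map _

/-- An element `a ∈ End⁰(X)ε_W` is determined by `a P_W` (its values on `Λ ∩ W`): `a P_W = 0 ⟹ a = 0`.
[cite: Lange2023AbelianVarietiesComplex, §1.1.2 Prop. 1.1.6 (injectivity of `ρ_r`), p. 20] -/
theorem eq_zero_of_mem_span_symmIdempotentElem_of_mul_latticeProj_eq_zero {a : endAlgRat Φ}
    (ha : a ∈ Ideal.span ({symmIdempotentElem Φ hη hW hWc} : Set (endAlgRat Φ)))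
    (h0 : (a : Matrix ι ι ℚ) * (subtorusMatrix W * retractionMatrix W).map (Int.cast : ℤ → ℚ) = 0) : a = 0 := by
  obtain ⟨b, rfl⟩ := Ideal.mem_span_singleton'.mp ha
  apply Subtype.ext
  rw [Subalgebra.coe_mul, coe_symmIdempotentElem, Subalgebra.coe_zero]
  refine ratMatrix_eq_of_mulVec_eq fun x => ?_
  have hx : (symmIdempotent Φ hη hW hWc).map (Rat.cast : ℚ → ℝ) *ᵥ x ∈ W := symmIdempotent_mulVec_mem Φ hη hW hWc x
  have h1 := congr_arg (fun N : Matrix ι ι ℚ => N.map (Rat.cast : ℚ → ℝ) *ᵥ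
    ((symmIdempotent Φ hη hW hWc).map (Rat.cast : ℚ → ℝ) *ᵥ x)) h0
  simp only [Subalgebra.coe_mul, coe_symmIdempotentElem, map_ratCast_mul, map_intCast_map_ratCast,
    ← Matrix.mulVec_mulVec, latticeProj_mulVec_of_mem hW hx, Matrix.map_zero _ Rat.cast_zero,
    Matrix.zero_mulVec] at h1
  rw [map_ratCast_mul, ← Matrix.mulVec_mulVec, Matrix.map_zero _ Rat.cast_zero, Matrix.zero_mulVec]
  rw [← symmIdempotent_mulVec_of_mem Φ hη hW hWc hx]
  rw [symmIdempotent_mulVec_of_mem Φ hη hW hWc hx] at h1 ⊢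
  exact h1

set_option synthInstance.maxHeartbeats 100000 in
/-- **`Hom(Y_W, X)` is a full `End(X)`-stable `ℤ`-lattice of the left ideal `End⁰(X)ε_W = Hom⁰(Y_W, X)`**
(finitely generated: it embeds into `M_ι(ℤ)` by `a ↦ aP_W`; spanning: a rational `aP_W` becomes integral
after clearing denominators). [cite: Lange2023AbelianVarietiesComplex, §1.1.2 Prop. 1.1.6 and Prop. 1.1.8 («`End_ℚ(X) = End(X) ⊗ ℚ`»), pp. 20, 22] -/
theorem isLattice_comap_homLattice {L : Submodule ℤ (endAlgRat Φ)}
    (hL : ∀ a : endAlgRat Φ, a ∈ L ↔ ∃ M : Matrix ι ι ℤ, M.map (Int.cast : ℤ → ℚ) =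
      (a : Matrix ι ι ℚ) * (subtorusMatrix W * retractionMatrix W).map (Int.cast : ℤ → ℚ)) :
    (L.comap ((Ideal.span ({symmIdempotentElem Φ hη hW hWc} : Set (endAlgRat Φ))).subtype.restrictScalars ℤ)).IsLattice ℚ
      ∧ ∀ r ∈ endSubmodule Φ, ∀ y ∈ L.comap ((Ideal.span ({symmIdempotentElem Φ hη hW hWc} :
        Set (endAlgRat Φ))).subtype.restrictScalars ℤ), r • y ∈ L.comap ((Ideal.span
          ({symmIdempotentElem Φ hη hW hWc} : Set (endAlgRat Φ))).subtype.restrictScalars ℤ) := by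
  set P : Matrix ι ι ℚ := (subtorusMatrix W * retractionMatrix W).map (Int.cast : ℤ → ℚ) with hP
  set I := Ideal.span ({symmIdempotentElem Φ hη hW hWc} : Set (endAlgRat Φ)) with hI
  -- `θ : a ↦ a P`, a `ℤ`-linear map `End⁰(X)ε_W → M_ι(ℚ)`, injective, with `L = θ⁻¹ M_ι(ℤ)`
  let θ : I →ₗ[ℤ] Matrix ι ι ℚ :=
    (LinearMap.mulRight ℤ P).comp (((endAlgRat Φ).val.toLinearMap.restrictScalars ℤ).comp (I.subtype.restrictScalars ℤ))
  have hθ : ∀ a : I, θ a = ((a : endAlgRat Φ) : Matrix ι ι ℚ) * P := fun a => rfl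
  have hθinj : Injective θ := by
    intro a b hab
    rw [hθ, hθ] at hab
    have hmem : (a : endAlgRat Φ) - b ∈ I := I.sub_mem a.2 b.2
    have h0 : (((a : endAlgRat Φ) - b : endAlgRat Φ) : Matrix ι ι ℚ) * P = 0 := by
      rw [AddSubgroupClass.coe_sub, Matrix.sub_mul, hab, sub_self]
    have := eq_zero_of_mem_span_symmIdempotentElem_of_mul_latticeProj_eq_zero Φ hη hW hWc hmem h0
    exact Subtype.ext (sub_eq_zero.mp this)
  have hLθ : L.comap (I.subtype.restrictScalars ℤ) =
      (Submodule.span ℤ (Set.range fun p : ι × ι => Matrix.single p.1 p.2 (1 : ℚ))).comap θ := by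
    ext a
    rw [Submodule.mem_comap, Submodule.mem_comap, mem_span_single_iff_exists_int, hθ]
    exact hL a
  refine ⟨?_, fun r hr y hy => ?_⟩
  · rw [hLθ]
    -- finitely generated: `θ` embeds the comap into `M_ι(ℤ)`
    have hfg : ((Submodule.span ℤ (Set.range fun p : ι × ι => Matrix.single p.1 p.2 (1 : ℚ))).comap θ).FG := by
      refine Submodule.fg_of_fg_map_injective θ hθinj (fg_of_le' (isLattice_span_single (n := ι)).fg ?_)
      exact Submodule.map_comap_le _ _
    -- full: clear the denominators of `a P`
    refine ⟨hfg, Submodule.eq_top_iff'.mpr fun a => ?_⟩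
    obtain ⟨k, hk, hka⟩ :=
      JordanZassenhaus.exists_int_smul_mem_of_isLattice (isLattice_span_single (n := ι)) (θ a)
    have hmem : ((k : ℚ) • a : I) ∈
        (Submodule.span ℤ (Set.range fun p : ι × ι => Matrix.single p.1 p.2 (1 : ℚ))).comap θ := by
      rw [Submodule.mem_comap, hθ, Submodule.coe_smul_of_tower, Subalgebra.coe_smul, smul_mul_assoc, ← hθ,
        Int.cast_smul_eq_zsmul]
      exact hka
    have ha : a = (k : ℚ)⁻¹ • ((k : ℚ) • a : I) := by
      rw [smul_smul, inv_mul_cancel₀ (Int.cast_ne_zero.mpr hk : (k : ℚ) ≠ 0), one_smul]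
    rw [ha]
    exact Submodule.smul_mem _ _ (Submodule.subset_span hmem)
  · rw [Submodule.mem_comap] at hy ⊢
    exact smul_mem_homLattice Φ hL r hr _ hy

end HomLattice

/-! ## §3 An `End⁰(X)`-isomorphism `Hom⁰(Y_W, X) ≃ Hom⁰(Y_{W′}, X)` of the pairs is induced by an isomorphism `Y_W ≅ Y_{W′}` -/

section Key

variable {η : E [⋀^Fin 2]→L[ℝ] ℝ} (hη : IsRiemannForm Φ η) {W W' : Submodule ℝ (ι → ℝ)}
  (hW : IsLatticeSubspace W) (hWc : IsComplexSubspace Φ W) (hW' : IsLatticeSubspace W') (hW'c : IsComplexSubspace Φ W')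

omit [DecidableEq ι] in
/-- `R_W C_W = 1` over `ℝ`: `R_ℝ (C_ℝ y) = y`. [cite: Lange2023AbelianVarietiesComplex, §1.1.6 Exercise (2)(a), p. 26] -/
private theorem retraction_mulVec_subtorus_mulVec (y : Fin (subRank W) → ℝ) :
    (retractionMatrix W).map (Int.cast : ℤ → ℝ) *ᵥ ((subtorusMatrix W).map (Int.cast : ℤ → ℝ) *ᵥ y) = y := by
  rw [Matrix.mulVec_mulVec, ← map_intCast_mul_real, retractionMatrix_mul_subtorusMatrix,
    Matrix.map_one Int.cast Int.cast_zero Int.cast_one, Matrix.one_mulVec]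

/-- **The geometric step.**  Let `c, d ∈ End⁰(X)` with `cd = ε_W`, `dc = ε_{W′}`, `dε_W = d`, `cε_{W′} = c`, and
suppose `d(Λ ∩ W) ⊆ Λ`, `c(Λ ∩ W′) ⊆ Λ` (`dP_W, cP_{W′} ∈ M_ι(ℤ)`).  Then `d` restricts to an isomorphism
`W ⥲ W′` carrying `Λ ∩ W` onto `Λ ∩ W′` (with inverse `c`), i.e. to an isomorphism of complex tori
`Y_W ≅ Y_{W′}`: the homomorphism `Y_W → X` with integral matrix `(dP_W)C_W` and `ℂ`-linear analytic
representation `ρ_a(d)|_{Φ(W)}` is injective with image `W′` (its matrix is `C_{W′}N` with `N = R_{W′}(dP_W)C_W`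
unimodular, `N⁻¹ = R_W(cP_{W′})C_{W′}`). [cite: Lange2023AbelianVarietiesComplex, §1.1.2 Prop. 1.1.6, §1.1.6 Exercise (3), pp. 20, 27] -/
theorem isIsomorphic_subtorusPeriod_of_intertwiner {c d : endAlgRat Φ}
    (hcd : c * d = symmIdempotentElem Φ hη hW hWc) (hdc : d * c = symmIdempotentElem Φ hη hW' hW'c)
    (hde : d * symmIdempotentElem Φ hη hW hWc = d) (hce : c * symmIdempotentElem Φ hη hW' hW'c = c)
    (hd : ∃ M : Matrix ι ι ℤ, M.map (Int.cast : ℤ → ℚ) =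
      (d : Matrix ι ι ℚ) * (subtorusMatrix W * retractionMatrix W).map (Int.cast : ℤ → ℚ))
    (hc : ∃ M : Matrix ι ι ℤ, M.map (Int.cast : ℤ → ℚ) =
      (c : Matrix ι ι ℚ) * (subtorusMatrix W' * retractionMatrix W').map (Int.cast : ℤ → ℚ)) :
    IsIsomorphic (subtorusPeriod Φ W hW hWc) (subtorusPeriod Φ W' hW' hW'c) := by
  obtain ⟨M₁, hM₁⟩ := hd
  obtain ⟨M₂, hM₂⟩ := hc
  have hd_e' : symmIdempotentElem Φ hη hW' hW'c * d = d := by rw [← hdc, mul_assoc, hcd, hde]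
  have hc_e : symmIdempotentElem Φ hη hW hWc * c = c := by rw [← hcd, mul_assoc, hdc, hce]
  -- real actions of `c`, `d`
  have hmulR : ∀ (a b : endAlgRat Φ) (x : ι → ℝ), ((a * b : endAlgRat Φ) : Matrix ι ι ℚ).map (Rat.cast : ℚ → ℝ) *ᵥ x =
      (a : Matrix ι ι ℚ).map (Rat.cast : ℚ → ℝ) *ᵥ ((b : Matrix ι ι ℚ).map (Rat.cast : ℚ → ℝ) *ᵥ x) := fun a b x => by
    rw [Subalgebra.coe_mul, map_ratCast_mul, Matrix.mulVec_mulVec]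
  have hdW' : ∀ x, (d : Matrix ι ι ℚ).map (Rat.cast : ℚ → ℝ) *ᵥ x ∈ W' := fun x => by
    rw [← hd_e', hmulR, coe_symmIdempotentElem]
    exact symmIdempotent_mulVec_mem Φ hη hW' hW'c _
  have hcW : ∀ x, (c : Matrix ι ι ℚ).map (Rat.cast : ℚ → ℝ) *ᵥ x ∈ W := fun x => by
    rw [← hc_e, hmulR, coe_symmIdempotentElem]
    exact symmIdempotent_mulVec_mem Φ hη hW hWc _
  have hcd_apply : ∀ w ∈ W, (c : Matrix ι ι ℚ).map (Rat.cast : ℚ → ℝ) *ᵥ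
      ((d : Matrix ι ι ℚ).map (Rat.cast : ℚ → ℝ) *ᵥ w) = w := fun w hw => by
    rw [← hmulR, hcd, coe_symmIdempotentElem, symmIdempotent_mulVec_of_mem Φ hη hW hWc hw]
  have hdc_apply : ∀ w' ∈ W', (d : Matrix ι ι ℚ).map (Rat.cast : ℚ → ℝ) *ᵥ
      ((c : Matrix ι ι ℚ).map (Rat.cast : ℚ → ℝ) *ᵥ w') = w' := fun w' hw' => by
    rw [← hmulR, hdc, coe_symmIdempotentElem, symmIdempotent_mulVec_of_mem Φ hη hW' hW'c hw']
  -- the integral matrices `dP_W`, `cP_{W'}` act as `d` on `W`, as `c` on `W'`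
  have hM₁W : ∀ w ∈ W, M₁.map (Int.cast : ℤ → ℝ) *ᵥ w = (d : Matrix ι ι ℚ).map (Rat.cast : ℚ → ℝ) *ᵥ w :=
    fun w hw => by
      rw [← map_intCast_map_ratCast M₁, hM₁, map_ratCast_mul, map_intCast_map_ratCast, ← Matrix.mulVec_mulVec,
        latticeProj_mulVec_of_mem hW hw]
  have hM₂W' : ∀ w' ∈ W', M₂.map (Int.cast : ℤ → ℝ) *ᵥ w' = (c : Matrix ι ι ℚ).map (Rat.cast : ℚ → ℝ) *ᵥ w' :=
    fun w' hw' => by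
      rw [← map_intCast_map_ratCast M₂, hM₂, map_ratCast_mul, map_intCast_map_ratCast, ← Matrix.mulVec_mulVec,
        latticeProj_mulVec_of_mem hW' hw']
  -- `A₀ = (dP_W)C_W` acts as `d ∘ C_W`
  have hA₀ : ∀ y, ((M₁ * subtorusMatrix W).map (Int.cast : ℤ → ℝ)) *ᵥ y =
      (d : Matrix ι ι ℚ).map (Rat.cast : ℚ → ℝ) *ᵥ ((subtorusMatrix W).map (Int.cast : ℤ → ℝ) *ᵥ y) := fun y => by
    rw [map_intCast_mul_real, ← Matrix.mulVec_mulVec, hM₁W _ (subtorusMatrix_mulVec_mem W y)]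
  -- `A₀ = C_{W'} N` with `N = R_{W'} A₀`
  have hS'N : subtorusMatrix W' * (retractionMatrix W' * (M₁ * subtorusMatrix W)) = M₁ * subtorusMatrix W := by
    refine intMatrix_eq_of_mulVec_eq fun y => ?_
    simp only [map_intCast_mul_real, ← Matrix.mulVec_mulVec]
    rw [hM₁W _ (subtorusMatrix_mulVec_mem W y), subtorusMatrix_mulVec_retractionMatrix_mulVec hW' (hdW' _)]
  -- `N' N = 1` with `N' = R_W (cP_{W'}) C_{W'}`
  have hN'N : retractionMatrix W * (M₂ * subtorusMatrix W') * (retractionMatrix W' * (M₁ * subtorusMatrix W)) = 1 := by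
    refine intMatrix_eq_of_mulVec_eq fun y => ?_
    simp only [map_intCast_mul_real, ← Matrix.mulVec_mulVec]
    rw [hM₁W _ (subtorusMatrix_mulVec_mem W y), subtorusMatrix_mulVec_retractionMatrix_mulVec hW' (hdW' _),
      hM₂W' _ (hdW' _), hcd_apply _ (subtorusMatrix_mulVec_mem W y), retraction_mulVec_subtorus_mulVec,
      Matrix.map_one Int.cast Int.cast_zero Int.cast_one, Matrix.one_mulVec]
  refine isIsomorphic_subtorusPeriod_of_injective Φ (subtorusPeriod Φ W hW hWc) (A := M₁ * subtorusMatrix W)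
    ?_ ?_ ?_ hW' hW'c
  · -- analytic representation `ρ_a(d)|_{Φ(W)}`
    refine ⟨(analyticRepHom Φ d).comp (cxSpan Φ W).subtypeL, fun y => ?_⟩
    rw [hA₀, ContinuousLinearMap.comp_apply, ← apply_mulVec_subtorusMatrix Φ W hW hWc, analyticRepHom_apply_apply]
  · -- injectivity: `A₀ = C_{W'} N`, `C_{W'}` injective on `Y_{W'}`, `N` unimodular
    rw [← hS'N]
    intro s t hst
    rw [← mapMatrix_mapMatrix (Φ' := subtorusPeriod Φ W' hW' hW'c) (subtorusMatrix W') _ s,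
      ← mapMatrix_mapMatrix (Φ' := subtorusPeriod Φ W' hW' hW'c) (subtorusMatrix W') _ t] at hst
    exact mapMatrix_injective_of_mul_eq_one (subtorusPeriod Φ W' hW' hW'c) (subtorusPeriod Φ W hW hWc) hN'N
      (subtorusMap_injective Φ W' hW' hW'c hst)
  · -- image `W'`
    ext w'
    constructor
    · intro hw'
      refine ⟨(retractionMatrix W).map (Int.cast : ℤ → ℝ) *ᵥ ((c : Matrix ι ι ℚ).map (Rat.cast : ℚ → ℝ) *ᵥ w'), ?_⟩
      rw [Matrix.mulVecLin_apply, hA₀, subtorusMatrix_mulVec_retractionMatrix_mulVec hW (hcW _), hdc_apply _ hw']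
    · rintro ⟨y, rfl⟩
      rw [Matrix.mulVecLin_apply, hA₀]
      exact hdW' _

set_option maxHeartbeats 400000 in
set_option synthInstance.maxHeartbeats 100000 in
/-- **The algebraic step (the counting device meets the tori).**  Let `L_W, L_{W′} ⊆ End⁰(X)` be the
integrality lattices of §2 and `γ : End⁰(X)ε_W ≃ End⁰(X)ε_{W′}` an `End⁰(X)`-linear isomorphism carrying
`Hom(Y_W, X) = L_W ∩ End⁰(X)ε_W` onto `Hom(Y_{W′}, X)`.  Then `Y_W ≅ Y_{W′}`: `γ` is right multiplication by
`c = γ(ε_W)`, its inverse by `d = γ⁻¹(ε_{W′})`, so `cd = ε_W`, `dc = ε_{W′}`; `c ∈ Hom(Y_{W′}, X)` as the image of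
`ε_W ∈ Hom(Y_W, X)`, and `d ∈ Hom(Y_W, X)` as the preimage of `ε_{W′}`; now apply
`isIsomorphic_subtorusPeriod_of_intertwiner`. [cite: Lange2023AbelianVarietiesComplex, §1.1.2 Prop. 1.1.6 and §2.4.3 Thm. 2.4.19, pp. 20, 121] [cite: Milne1986AbelianVarieties, §18 Lemma 18.8 (proof pattern)] -/
theorem isIsomorphic_subtorusPeriod_of_linearEquiv {L L' : Submodule ℤ (endAlgRat Φ)}
    (hL : ∀ a : endAlgRat Φ, a ∈ L ↔ ∃ M : Matrix ι ι ℤ, M.map (Int.cast : ℤ → ℚ) =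
      (a : Matrix ι ι ℚ) * (subtorusMatrix W * retractionMatrix W).map (Int.cast : ℤ → ℚ))
    (hL' : ∀ a : endAlgRat Φ, a ∈ L' ↔ ∃ M : Matrix ι ι ℤ, M.map (Int.cast : ℤ → ℚ) =
      (a : Matrix ι ι ℚ) * (subtorusMatrix W' * retractionMatrix W').map (Int.cast : ℤ → ℚ))
    (γ : Ideal.span ({symmIdempotentElem Φ hη hW hWc} : Set (endAlgRat Φ)) ≃ₗ[endAlgRat Φ]
      Ideal.span ({symmIdempotentElem Φ hη hW' hW'c} : Set (endAlgRat Φ)))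
    (hγ : (L.comap ((Ideal.span ({symmIdempotentElem Φ hη hW hWc} : Set (endAlgRat Φ))).subtype.restrictScalars ℤ)).map
        ((γ : Ideal.span ({symmIdempotentElem Φ hη hW hWc} : Set (endAlgRat Φ)) →ₗ[endAlgRat Φ]
          Ideal.span ({symmIdempotentElem Φ hη hW' hW'c} : Set (endAlgRat Φ))).restrictScalars ℤ) =
      L'.comap ((Ideal.span ({symmIdempotentElem Φ hη hW' hW'c} : Set (endAlgRat Φ))).subtype.restrictScalars ℤ)) :
    IsIsomorphic (subtorusPeriod Φ W hW hWc) (subtorusPeriod Φ W' hW' hW'c) := by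
  have he : IsIdempotentElem (symmIdempotentElem Φ hη hW hWc) := isIdempotentElem_symmIdempotentElem Φ hη hW hWc
  have he' : IsIdempotentElem (symmIdempotentElem Φ hη hW' hW'c) := isIdempotentElem_symmIdempotentElem Φ hη hW' hW'c
  have hem : symmIdempotentElem Φ hη hW hWc ∈ Ideal.span ({symmIdempotentElem Φ hη hW hWc} : Set (endAlgRat Φ)) :=
    Ideal.subset_span rfl
  have he'm : symmIdempotentElem Φ hη hW' hW'c ∈ Ideal.span ({symmIdempotentElem Φ hη hW' hW'c} : Set (endAlgRat Φ)) :=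
    Ideal.subset_span rfl
  -- `γ` is right multiplication by `c = γ(ε_W)` on `bε_W`, `γ⁻¹` by `d = γ⁻¹(ε_{W'})` on `bε_{W'}`
  have hγa : ∀ b : endAlgRat Φ, (γ ⟨b * symmIdempotentElem Φ hη hW hWc, Ideal.mul_mem_left _ b hem⟩ : endAlgRat Φ) =
      b * γ ⟨_, hem⟩ := fun b => by
    have h : (⟨b * symmIdempotentElem Φ hη hW hWc, Ideal.mul_mem_left _ b hem⟩ :
        Ideal.span ({symmIdempotentElem Φ hη hW hWc} : Set (endAlgRat Φ))) = b • ⟨_, hem⟩ := rfl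
    rw [h, map_smul, Submodule.coe_smul, smul_eq_mul]
  have hγb : ∀ b : endAlgRat Φ, (γ.symm ⟨b * symmIdempotentElem Φ hη hW' hW'c, Ideal.mul_mem_left _ b he'm⟩ :
      endAlgRat Φ) = b * γ.symm ⟨_, he'm⟩ := fun b => by
    have h : (⟨b * symmIdempotentElem Φ hη hW' hW'c, Ideal.mul_mem_left _ b he'm⟩ :
        Ideal.span ({symmIdempotentElem Φ hη hW' hW'c} : Set (endAlgRat Φ))) = b • ⟨_, he'm⟩ := rfl
    rw [h, map_smul, Submodule.coe_smul, smul_eq_mul]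
  have hce : (γ ⟨_, hem⟩ : endAlgRat Φ) * symmIdempotentElem Φ hη hW' hW'c = γ ⟨_, hem⟩ := by
    obtain ⟨b', hb'⟩ := Ideal.mem_span_singleton'.mp (γ ⟨_, hem⟩).2
    rw [← hb', mul_assoc, he'.eq]
  have hde : (γ.symm ⟨_, he'm⟩ : endAlgRat Φ) * symmIdempotentElem Φ hη hW hWc = γ.symm ⟨_, he'm⟩ := by
    obtain ⟨b', hb'⟩ := Ideal.mem_span_singleton'.mp (γ.symm ⟨_, he'm⟩).2
    rw [← hb', mul_assoc, he.eq]
  have hcd : (γ ⟨_, hem⟩ : endAlgRat Φ) * γ.symm ⟨_, he'm⟩ = symmIdempotentElem Φ hη hW hWc := by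
    have h2 := hγb (γ ⟨_, hem⟩ : endAlgRat Φ)
    have h3 : (⟨(γ ⟨_, hem⟩ : endAlgRat Φ) * symmIdempotentElem Φ hη hW' hW'c, Ideal.mul_mem_left _ _ he'm⟩ :
        Ideal.span ({symmIdempotentElem Φ hη hW' hW'c} : Set (endAlgRat Φ))) = γ ⟨_, hem⟩ := Subtype.ext hce
    rw [h3, LinearEquiv.symm_apply_apply] at h2
    exact h2.symm
  have hdc : (γ.symm ⟨_, he'm⟩ : endAlgRat Φ) * γ ⟨_, hem⟩ = symmIdempotentElem Φ hη hW' hW'c := by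
    have h2 := hγa (γ.symm ⟨_, he'm⟩ : endAlgRat Φ)
    have h3 : (⟨(γ.symm ⟨_, he'm⟩ : endAlgRat Φ) * symmIdempotentElem Φ hη hW hWc, Ideal.mul_mem_left _ _ hem⟩ :
        Ideal.span ({symmIdempotentElem Φ hη hW hWc} : Set (endAlgRat Φ))) = γ.symm ⟨_, he'm⟩ := Subtype.ext hde
    rw [h3, LinearEquiv.apply_symm_apply] at h2
    exact h2.symm
  -- `c ∈ Hom(Y_{W'}, X)`: image of `ε_W ∈ Hom(Y_W, X)`
  have hc : (γ ⟨_, hem⟩ : endAlgRat Φ) ∈ L' := by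
    have h : (⟨_, hem⟩ : Ideal.span ({symmIdempotentElem Φ hη hW hWc} : Set (endAlgRat Φ))) ∈
        L.comap ((Ideal.span ({symmIdempotentElem Φ hη hW hWc} : Set (endAlgRat Φ))).subtype.restrictScalars ℤ) := by
      rw [Submodule.mem_comap]
      exact symmIdempotentElem_mem_homLattice Φ hη hW hWc hL
    have h2 := Submodule.mem_map_of_mem
      (f := ((γ : Ideal.span ({symmIdempotentElem Φ hη hW hWc} : Set (endAlgRat Φ)) →ₗ[endAlgRat Φ]
        Ideal.span ({symmIdempotentElem Φ hη hW' hW'c} : Set (endAlgRat Φ))).restrictScalars ℤ)) h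
    rw [hγ, Submodule.mem_comap] at h2
    exact h2
  -- `d ∈ Hom(Y_W, X)`: preimage of `ε_{W'} ∈ Hom(Y_{W'}, X)`
  have hd : (γ.symm ⟨_, he'm⟩ : endAlgRat Φ) ∈ L := by
    have h : (⟨_, he'm⟩ : Ideal.span ({symmIdempotentElem Φ hη hW' hW'c} : Set (endAlgRat Φ))) ∈
        L'.comap ((Ideal.span ({symmIdempotentElem Φ hη hW' hW'c} : Set (endAlgRat Φ))).subtype.restrictScalars ℤ) := by
      rw [Submodule.mem_comap]
      exact symmIdempotentElem_mem_homLattice Φ hη hW' hW'c hL'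
    rw [← hγ, Submodule.mem_map] at h
    obtain ⟨x, hx, hxe⟩ := h
    have hx' : x = γ.symm ⟨_, he'm⟩ := by
      rw [← hxe]
      exact (γ.symm_apply_apply x).symm
    rw [Submodule.mem_comap, hx'] at hx
    exact hx
  exact isIsomorphic_subtorusPeriod_of_intertwiner Φ hη hW hWc hW' hW'c hcd hdc hde hce ((hL _).mp hd) ((hL' _).mp hc)

end Key

/-! ## §4 LENSTRA–OORT–ZARHIN: finitely many abelian subvarieties up to isomorphism -/

section Main

variable {η : E [⋀^Fin 2]→L[ℝ] ℝ}

set_option synthInstance.maxHeartbeats 100000 in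
/-- **Lenstra–Oort–Zarhin for complex abelian varieties (polarised form).**  Let `X = E/Φ(ℤ^ι)` be a complex
torus with a Riemann form `η`.  Then the abelian subvarieties `Y_W = Φ(W)/Φ(W ∩ ℤ^ι)` of `X` (`W ⊆ ℝ^ι` a rational
complex subspace) fall into FINITELY MANY isomorphism classes of complex tori.  Proof: `Y_W ↦` the pair (left ideal
`End⁰(X)ε_W`, lattice `Hom(Y_W, X)`) of the finite-dimensional semisimple `ℚ`-algebra `End⁰(X)` with its order
`End(X)`; such pairs fall into finitely many isomorphism classes by the Jordan–Zassenhaus theorem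
(`JordanZassenhaus.finite_quot_linearEquiv_span_singleton_of_isLattice`), and isomorphic pairs come from isomorphic
abelian subvarieties (§3). [cite: LenstraOortZarhin1996AbelianSubvarieties, main theorem, pp. 513–516 (case k = ℂ)] [cite: Caucci2025KobayashiHyperbolicityAbelian, footnote to (conj000), chunk p0008 («up to isomorphism, only finitely many abelian subvarieties in A (see [lenstra])»)] [cite: Milne1986AbelianVarieties, §18 Thm. 18.7, Lemma 18.8 (method)] -/
theorem IsRiemannForm.finite_quot_isIsomorphic_subtorusPeriod (hη : IsRiemannForm Φ η) :
    Finite (Quot (fun Y Y' : {W : Submodule ℝ (ι → ℝ) // IsLatticeSubspace W ∧ IsComplexSubspace Φ W} =>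
      IsIsomorphic (subtorusPeriod Φ Y.1 Y.2.1 Y.2.2) (subtorusPeriod Φ Y'.1 Y'.2.1 Y'.2.2))) := by
  classical
  haveI : IsSemisimpleRing (endAlgRat Φ) := IsAbelianVariety.isSemisimpleRing_endAlgRat ⟨η, hη⟩
  choose L hL using fun Y : {W : Submodule ℝ (ι → ℝ) // IsLatticeSubspace W ∧ IsComplexSubspace Φ W} =>
    exists_homLattice Φ Y.1
  have hfin := JordanZassenhaus.finite_quot_linearEquiv_span_singleton_of_isLattice (B := endAlgRat Φ)
    (isLattice_endSubmodule Φ)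
    (fun Y : {W : Submodule ℝ (ι → ℝ) // IsLatticeSubspace W ∧ IsComplexSubspace Φ W} =>
      symmIdempotentElem Φ hη Y.2.1 Y.2.2)
    (fun Y => (L Y).comap ((Ideal.span ({symmIdempotentElem Φ hη Y.2.1 Y.2.2} : Set (endAlgRat Φ))).subtype.restrictScalars ℤ))
    (fun Y => isLattice_comap_homLattice Φ hη Y.2.1 Y.2.2 (hL Y))
  refine @Finite.of_surjective _ _ hfin (Quot.map id fun Y Y' h => ?_) (Quot.map_surjective _ surjective_id)
  obtain ⟨γ, hγ⟩ := h
  exact isIsomorphic_subtorusPeriod_of_linearEquiv Φ hη Y.2.1 Y.2.2 Y'.2.1 Y'.2.2 (hL Y) (hL Y') γ hγ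

/-- **LENSTRA–OORT–ZARHIN (1996) for complex abelian varieties: up to isomorphism, an abelian variety has only
finitely many abelian subvarieties.**  For a complex abelian variety `X = E/Φ(ℤ^ι)` (a polarisable complex torus)
the abelian subvarieties `Y_W ⊆ X` fall into finitely many isomorphism classes. [cite: LenstraOortZarhin1996AbelianSubvarieties, main theorem, pp. 513–516 (case k = ℂ)] [cite: Caucci2025KobayashiHyperbolicityAbelian, footnote to (conj000), chunk p0008] [cite: Lange2023AbelianVarietiesComplex, §2.4.4 Cor. 2.4.26] -/
theorem IsAbelianVariety.finite_quot_isIsomorphic_subtorusPeriod {Φ : (ι → ℝ) ≃L[ℝ] E} (h : IsAbelianVariety Φ) :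
    Finite (Quot (fun Y Y' : {W : Submodule ℝ (ι → ℝ) // IsLatticeSubspace W ∧ IsComplexSubspace Φ W} =>
      IsIsomorphic (subtorusPeriod Φ Y.1 Y.2.1 Y.2.2) (subtorusPeriod Φ Y'.1 Y'.2.1 Y'.2.2))) := by
  obtain ⟨η, hη⟩ := h
  exact hη.finite_quot_isIsomorphic_subtorusPeriod Φ

end Main

end ComplexTorus

end Literature.Geometry.Kaehler
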